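import Literature.NumberTheory.EllipticCurves.Agboola2007.RestrictedSelmerGroups
import Literature.NumberTheory.EllipticCurves.ZpExtensionIdelicCharacterProofs
import Literature.NumberTheory.EllipticCurves.ZpExtensionGlobalReciprocityProofs
import Literature.NumberTheory.EllipticCurves.ZpExtensionUnramifiedProofs
import Literature.NumberTheory.EllipticCurves.ZpExtensionDihedralProofs
import Literature.NumberTheory.GaloisRepresentations.GlobalReciprocityExistenceProofs
import Literature.NumberTheory.GaloisRepresentations.LocalOneUnitsNumberFieldProofs
import Literature.NumberTheory.GaloisRepresentations.IdelicCharacterProofs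
import HarnessLib

/-!
# The `ℤ_p`-line of an imaginary quadratic field unramified outside ONE split prime: existence and uniqueness (proofs only)

Topic `NumberTheory/EllipticCurves` (Iwasawa theory of `ℤ_p`-extensions); namespace
`Literature.NumberTheory.EllipticCurves.ZpExtension`. THEOREMS ONLY (no definition, no named fact, no instance; D-0026).

This file DISCHARGES the named fact (R2) of `Agboola2007/RestrictedSelmerGroups.lean`,

* `Literature.NumberTheory.EllipticCurves.ZpExtension.existsUnique_isUnramifiedOutside_of_split` — for `K` imaginary quadratic and a prime
  `p` with two places `v ≠ v̄` above it, there IS a `ℤ_p`-extension of `K` unramified outside `v`, and any two have the same kernel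
  (Agboola 2007 §1 «the unique `ℤ_p` extension of `K` unramified outside `𝔭`»; de Shalit 1987 II.4.17; Coates 1983 §2; Müller 2020 §1
  for `p = 2`) —

as `existsUnique_isUnramifiedOutside_of_split_holds`, from the tree's PROVED global class field theory: the idelic character of a
`ℤ_p`-extension (`ZpExtensionIdelicCharacterProofs`), the global reciprocity law (`exists_isGlobalReciprocityMap_holds`) through the
`ℤ_p`-rank supply `exists_pair_of_globalReciprocity` (`Gal(K̃/K) ↠ ℤ_p²`), Washington's Prop. 13.2 (`inertia_le_kerSubgroup_holds`) and the
local rank count `OneUnits.exists_continuousMonoidHom_adicCompletionIntegers_rank` / `OneUnits.sum_eq_finrank`. The proof is Washington's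
proof of Thm. 13.4 (§13.1) run at ONE place:

* §1 places: in a quadratic field with `v ≠ v̄ ∋ p` there is no third place above `p`, and `Hom_cont(𝒪_{v̄}ˣ, ℤ_p)` has `ℤ_p`-rank ONE
  (`n_u ≥ 1` at each `u ∣ p` since `p` is a non-unit of `𝒪_u`, and `Σ_{u∣p} n_u = [K:ℚ] = 2`);
* §2 the idelic character `Λ` of a line `κ`: `Λ(𝒪_uˣ) = 1` iff `I_u ≤ ker κ` at `u ∣ p` (local symbol `Λ(⟨a_u w⟩) = κ(res w)⁻¹` and
  `a_u(I) = 𝒪_uˣ`), and `= 1` at `u ∤ p` always (Prop. 13.2); so «unramified outside `v`» ⟺ «`Λ` kills `𝒪_{v̄}ˣ`»;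
* §3 UNIQUENESS: for `κ, κ'` unramified outside `v̄`, `p^N Λ = c φ`, `p^N Λ' = c' φ` on `𝒪_{v̄}ˣ` with `c, c' ≠ 0` (else `Λ` kills all local
  units above `p`, `exists_idelicCharacter_localUnits_ne_one`); `c'Λ − cΛ'` kills `Kˣ` and `∏_{u∣p} 𝒪_uˣ`, hence is trivial
  (`IdelicCharacter.eq_one_of_forall_localUnits`), so `c'κ = cκ'` and `ker κ = ker κ'`;
* §4 EXISTENCE: two jointly surjective characters `κ₁, κ₂ : Γ_K → ℤ_p` (`exists_pair_of_globalReciprocity`); by rank one at `v̄` some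
  combination `χ = c₂κ₁ − c₁κ₂ ≠ 0` has idelic character killing `𝒪_{v̄}ˣ`; its saturation (`exists_surjective_of_ne_one`) is a
  `ℤ_p`-extension unramified at `v̄`, hence outside `v` (if `c₁ = c₂ = 0`, `κ₁` itself is);
* §5 the assembly `existsUnique_isUnramifiedOutside_of_split_holds` (both orientations by the symmetry `v ↔ v̄` of the hypotheses).

(The uniqueness half was first landed in Summits currency by cell `bsd-print-cf2`, `…Theorems.PrintCf2SplitBadTwoLineUniqueness`
(p668502); this is its Literature form plus existence.)

## References

* [Washington1997] L. C. Washington, *Introduction to Cyclotomic Fields*, 2nd ed., GTM 83, §13.1: Prop. 13.2, Thm. 13.4 and its proof.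
* [Lang1990] S. Lang, *Cyclotomic Fields I and II*, GTM 121, Ch. 5 §5, Thm. 5.1–5.2.
* [Agboola2007] A. Agboola, *On Rubin's variant of the p-adic Birch and Swinnerton-Dyer conjecture*, Compos. Math. 143 (2007), §1.
* [deShalit1987] E. de Shalit, *Iwasawa theory of elliptic curves with complex multiplication*, Perspect. Math. 3 (1987), II §4.17.
* [Coates1983InfiniteDescent] J. Coates, *Infinite descent on elliptic curves with complex multiplication* (1983), §2.
* [NeukirchANT1999] J. Neukirch, *Algebraic Number Theory* (1999), Ch. II (5.7), Ch. VI (5.6).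

## Tree search

`lean search 'existsUnique_isUnramifiedOutside_of_split_holds|kerSubgroup_eq_of_isUnramifiedOutside|exists_isUnramifiedOutside_of_split'`:
only the Summits-side `PrintCf2.LineDecomposition.*` (cell bsd-print-cf2, same author) — no Literature proof; this file supplies it.
-/

noncomputable section

open Field NumberField IsDedekindDomain

namespace Literature.NumberTheory.EllipticCurves.ZpExtension

open Literature.NumberTheory.GaloisRepresentations Literature.NumberTheory.NumberFields

variable {K : Type} [Field K] [NumberField K] {p : ℕ} [Fact p.Prime]

/-! ### §1. Places above a split prime of a quadratic field; local rank one -/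

omit [Fact p.Prime] in
/-- **`n_u ≥ 1` at `u ∣ p`**: if `p ∈ u` then `#(𝒪_u / p 𝒪_u) = p^n` forces `1 ≤ n` (`p` lies in the maximal ideal of `𝒪_u`).
[cite: NeukirchANT1999, Ch. II §5 Prop. (5.7)] -/
theorem one_le_of_natCard_quot_adicCompletionIntegers_eq_pow {u : HeightOneSpectrum (𝓞 K)} (hu : ((p : ℕ) : 𝓞 K) ∈ u.asIdeal)
    {n : ℕ} (hn : Nat.card (u.adicCompletionIntegers K ⧸ Ideal.span {(p : u.adicCompletionIntegers K)}) = p ^ n) :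
    1 ≤ n := by
  by_contra h
  have hn0 : n = 0 := by omega
  rw [hn0, pow_zero] at hn
  haveI : Finite (u.adicCompletionIntegers K ⧸ Ideal.span {(p : u.adicCompletionIntegers K)}) :=
    Nat.finite_of_card_ne_zero (by rw [hn]; exact one_ne_zero)
  have hsub : Subsingleton (u.adicCompletionIntegers K ⧸ Ideal.span {(p : u.adicCompletionIntegers K)}) :=
    (Nat.card_eq_one_iff_unique.mp hn).1
  have hunit : IsUnit (p : u.adicCompletionIntegers K) :=
    (Ideal.span_singleton_eq_top).mp (Ideal.Quotient.subsingleton_iff.mp hsub)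
  have h1 := (Valuation.Integers.isUnit_iff_valuation_eq_one (Valuation.valuationSubring.integers _)).1 hunit
  change Valued.v (((p : u.adicCompletionIntegers K) : u.adicCompletionIntegers K) : u.adicCompletion K) = 1 at h1
  have hp1 : Valued.v (((p : u.adicCompletionIntegers K) : u.adicCompletionIntegers K) : u.adicCompletion K) < 1 := by
    rw [OneUnits.valued_natCast_adicCompletionIntegers]
    exact (u.intValuation_lt_one_iff_mem _).2 hu
  rw [h1] at hp1
  exact lt_irrefl _ hp1

/-- The local ranks `n_u` (`p^{n_u} = #(𝒪_u/p)`) at the places `u ∣ p` of a number field, packaged: a finite set `T ⊇ {u ∣ p}`, the ranks,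
the exponents `N_u` and the characters `φ_{u,i}` with `p^{N_u} ψ = Σ c_i φ_{u,i}` for every continuous `ψ : 𝒪_uˣ → ℤ_p`, and
`Σ_{u ∈ T} n_u = [K : ℚ]` (`OneUnits.exists_continuousMonoidHom_adicCompletionIntegers_rank`, `OneUnits.sum_eq_finrank`).
[cite: Washington1997, §13.1 (proof of Thm. 13.4)] [cite: NeukirchANT1999, Ch. II §5 Prop. (5.7)] -/
theorem exists_localRanks :
    ∃ (T : Finset (HeightOneSpectrum (𝓞 K))) (n N : HeightOneSpectrum (𝓞 K) → ℕ)
      (φ : ∀ w : HeightOneSpectrum (𝓞 K), Fin (n w) → ((w.adicCompletionIntegers K)ˣ →ₜ* Multiplicative ℤ_[p])),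
      (∀ w : HeightOneSpectrum (𝓞 K), ((p : ℕ) : 𝓞 K) ∈ w.asIdeal ↔ w ∈ T) ∧
      (∑ w ∈ T, n w = Module.finrank ℚ K) ∧
      ∀ w : HeightOneSpectrum (𝓞 K), ((p : ℕ) : 𝓞 K) ∈ w.asIdeal →
        Nat.card (w.adicCompletionIntegers K ⧸ Ideal.span {(p : w.adicCompletionIntegers K)}) = p ^ n w ∧
        ∀ ψ : (w.adicCompletionIntegers K)ˣ →ₜ* Multiplicative ℤ_[p], ∃ c : Fin (n w) → ℤ_[p],
          ∀ y : (w.adicCompletionIntegers K)ˣ, (p : ℤ_[p]) ^ N w * (ψ y).toAdd = ∑ i, c i * (φ w i y).toAdd := by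
  classical
  have hp : p.Prime := Fact.out
  have hfin : {w : HeightOneSpectrum (𝓞 K) | (p : 𝓞 K) ∈ w.asIdeal}.Finite := by
    have hp0 : (Ideal.span {(p : 𝓞 K)} : Ideal (𝓞 K)) ≠ 0 := by
      rw [Ne, Ideal.zero_eq_bot, Ideal.span_singleton_eq_bot]
      exact_mod_cast hp.ne_zero
    refine (Ideal.finite_factors hp0).subset fun w hw => ?_
    change w.asIdeal ∣ Ideal.span {(p : 𝓞 K)}
    rw [Ideal.dvd_span_singleton]
    exact hw
  let T : Finset (HeightOneSpectrum (𝓞 K)) := hfin.toFinset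
  have hT : ∀ w : HeightOneSpectrum (𝓞 K), (p : 𝓞 K) ∈ w.asIdeal ↔ w ∈ T := fun w => by
    rw [Set.Finite.mem_toFinset]
    rfl
  have hloc : ∀ w : HeightOneSpectrum (𝓞 K), ∃ (n N : ℕ)
      (φ : Fin n → ((w.adicCompletionIntegers K)ˣ →ₜ* Multiplicative ℤ_[p])),
      ((p : 𝓞 K) ∈ w.asIdeal →
        Nat.card (w.adicCompletionIntegers K ⧸ Ideal.span {(p : w.adicCompletionIntegers K)}) = p ^ n ∧
        ∀ ψ' : (w.adicCompletionIntegers K)ˣ →ₜ* Multiplicative ℤ_[p], ∃ c : Fin n → ℤ_[p],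
          ∀ u : (w.adicCompletionIntegers K)ˣ,
            (p : ℤ_[p]) ^ N * (ψ' u).toAdd = ∑ i, c i * (φ i u).toAdd) := by
    intro w
    by_cases hw : (p : 𝓞 K) ∈ w.asIdeal
    · obtain ⟨n, N, φ, hcard, -, hspan⟩ :=
        OneUnits.exists_continuousMonoidHom_adicCompletionIntegers_rank K w p hw
      exact ⟨n, N, φ, fun _ => ⟨hcard, hspan⟩⟩
    · exact ⟨0, 0, Fin.elim0, fun h => absurd h hw⟩
  choose n N φ hnφ using hloc
  exact ⟨T, n, N, φ, hT,
    OneUnits.sum_eq_finrank K p T (fun w hw => (hT w).1 hw) n fun w hw => (hnφ w ((hT w).2 hw)).1, hnφ⟩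

/-- **In a quadratic field, two places `v ≠ v̄` above `p` are ALL the places above `p`** (no Galois theory: a third place `u ∋ p` would give
`n_v + n_{v̄} + n_u ≤ Σ_{w∣p} n_w = [K:ℚ] = 2` with each `n ≥ 1`). [cite: NeukirchANT1999, Ch. I §8 Prop. (8.2) and Ch. II (8.4)] -/
theorem eq_or_eq_of_natCast_mem_of_finrank_eq_two (hK2 : Module.finrank ℚ K = 2)
    {v vbar : HeightOneSpectrum (𝓞 K)} (hv : ((p : ℕ) : 𝓞 K) ∈ v.asIdeal) (hvbar : ((p : ℕ) : 𝓞 K) ∈ vbar.asIdeal)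
    (hne : vbar ≠ v) {u : HeightOneSpectrum (𝓞 K)} (hu : ((p : ℕ) : 𝓞 K) ∈ u.asIdeal) : u = v ∨ u = vbar := by
  classical
  by_contra hnot
  rw [not_or] at hnot
  obtain ⟨T, n, N, φ, hT, hsum, hnφ⟩ := exists_localRanks (K := K) (p := p)
  have h1 : 1 ≤ n v := one_le_of_natCard_quot_adicCompletionIntegers_eq_pow hv (hnφ v hv).1
  have h2 : 1 ≤ n vbar := one_le_of_natCard_quot_adicCompletionIntegers_eq_pow hvbar (hnφ vbar hvbar).1
  have h3 : 1 ≤ n u := one_le_of_natCard_quot_adicCompletionIntegers_eq_pow hu (hnφ u hu).1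
  have hsub : ({v, vbar, u} : Finset (HeightOneSpectrum (𝓞 K))) ⊆ T := by
    intro w hw
    simp only [Finset.mem_insert, Finset.mem_singleton] at hw
    rcases hw with rfl | rfl | rfl
    · exact (hT _).1 hv
    · exact (hT _).1 hvbar
    · exact (hT _).1 hu
  have hle : ∑ w ∈ ({v, vbar, u} : Finset (HeightOneSpectrum (𝓞 K))), n w ≤ ∑ w ∈ T, n w :=
    Finset.sum_le_sum_of_subset hsub
  rw [Finset.sum_insert (by simp only [Finset.mem_insert, Finset.mem_singleton, not_or]; exact ⟨hne.symm, fun h => hnot.1 h.symm⟩),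
    Finset.sum_pair (fun h => hnot.2 h.symm), hsum, hK2] at hle
  omega

/-- **At a split prime the local unit group has `ℤ_p`-rank ONE.** `[K:ℚ] = 2`, `v ≠ v̄` above `p`: there are `N` and ONE continuous
character `φ : 𝒪_{v̄}ˣ → ℤ_p` with `p^N ψ = c φ` for every continuous `ψ : 𝒪_{v̄}ˣ → ℤ_p` (`rank_{ℤ_p} U_{v̄} = [K_{v̄}:ℚ_p] = 1`).
[cite: Washington1997, §13.1 (proof of Thm. 13.4)] [cite: NeukirchANT1999, Ch. II §5 Prop. (5.7)] -/
theorem exists_localRank_one_of_split (hK2 : Module.finrank ℚ K = 2)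
    {v vbar : HeightOneSpectrum (𝓞 K)} (hv : ((p : ℕ) : 𝓞 K) ∈ v.asIdeal) (hvbar : ((p : ℕ) : 𝓞 K) ∈ vbar.asIdeal)
    (hne : vbar ≠ v) :
    ∃ (N : ℕ) (φ : (vbar.adicCompletionIntegers K)ˣ →ₜ* Multiplicative ℤ_[p]),
      ∀ ψ : (vbar.adicCompletionIntegers K)ˣ →ₜ* Multiplicative ℤ_[p], ∃ c : ℤ_[p],
        ∀ y : (vbar.adicCompletionIntegers K)ˣ, (p : ℤ_[p]) ^ N * (ψ y).toAdd = c * (φ y).toAdd := by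
  classical
  obtain ⟨T, n, N, φ, hT, hsum, hnφ⟩ := exists_localRanks (K := K) (p := p)
  rw [hK2] at hsum
  have hv1 : 1 ≤ n v := one_le_of_natCard_quot_adicCompletionIntegers_eq_pow hv (hnφ v hv).1
  have hvbar1 : 1 ≤ n vbar := one_le_of_natCard_quot_adicCompletionIntegers_eq_pow hvbar (hnφ vbar hvbar).1
  have hle : n v + n vbar ≤ ∑ w ∈ T, n w := by
    have hsub : ({v, vbar} : Finset (HeightOneSpectrum (𝓞 K))) ⊆ T := by
      intro w hw
      rw [Finset.mem_insert, Finset.mem_singleton] at hw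
      rcases hw with rfl | rfl
      · exact (hT _).1 hv
      · exact (hT _).1 hvbar
    rw [← Finset.sum_pair hne.symm]
    exact Finset.sum_le_sum_of_subset hsub
  have hnvbar : n vbar = 1 := by omega
  obtain ⟨-, hspan⟩ := hnφ vbar hvbar
  refine ⟨N vbar, φ vbar ⟨0, by rw [hnvbar]; exact Nat.one_pos⟩, fun ψ => ?_⟩
  obtain ⟨c, hc⟩ := hspan ψ
  refine ⟨c ⟨0, by rw [hnvbar]; exact Nat.one_pos⟩, fun y => ?_⟩
  rw [hc y]
  have huniv : (Finset.univ : Finset (Fin (n vbar))) = {⟨0, by rw [hnvbar]; exact Nat.one_pos⟩} := by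
    ext i
    simp only [Finset.mem_univ, Finset.mem_singleton, true_iff]
    ext
    have := i.2
    omega
  rw [huniv, Finset.sum_singleton]

/-! ### §2. The idelic character on the local units: ramification criterion -/

section Idelic

variable (κ : ZpExtension K p) {Λ : ideleGroup K →ₜ* Multiplicative ℤ_[p]}
  (hΛ : ∀ (a : ideleGroup K) (γ : absoluteGaloisGroup K),
    absGaloisAbProj K γ = ideleArtinMap K a → Λ a = κ.toContinuousMonoidHom γ)
include hΛ

/-- **`Λ(⟨𝒪_uˣ⟩) = 1` where the line is unramified (`I_u ≤ ker κ`), also above `p`**: a local unit is `a_u(w)` for `w` in the Weil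
inertia (`IsLocalArtinMap.image_inertia`), and `Λ(⟨a_u w⟩_u) = κ(res_u w)⁻¹ = 1`. (Literature form of cell bsd-print-cf2's
`LineDecomposition.idelicCharacter_localUnits_eq_one_of_inertia_le`.) [cite: NeukirchANT1999, Ch. VI §5 Prop. (5.6)]
[cite: CasselsFrohlichANT1967, Ch. VII §4.2 Corollary (iii)] -/
theorem idelicCharacter_localUnits_eq_one_of_inertia_le {u : HeightOneSpectrum (𝓞 K)}
    (hI : GreenbergSelmer.inertia u ≤ κ.kerSubgroup) (y : (u.adicCompletion K)ˣ)
    (hy : Valued.v (y : u.adicCompletion K) = 1) : Λ (localUnits u y) = 1 := by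
  have ha := isLocalArtinMap_canonicalArtin_holds (u.adicCompletion K)
  have hle : ∀ x z : u.adicCompletion K,
      ValuativeRel.valuation (u.adicCompletion K) x ≤ ValuativeRel.valuation (u.adicCompletion K) z ↔ Valued.v x ≤ Valued.v z :=
    fun x z ↦ (Valuation.vle_iff_le (ValuativeRel.valuation (u.adicCompletion K))).symm.trans (Valuation.vle_iff_le Valued.v)
  have hy' : ValuativeRel.valuation (u.adicCompletion K) (y : u.adicCompletion K) = 1 := by
    refine le_antisymm ?_ ?_ <;>
      rw [← (ValuativeRel.valuation (u.adicCompletion K)).map_one, hle, Valued.v.map_one, hy]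
  have hmem : y ∈ (ValuativeRel.valuation (u.adicCompletion K)).valuationSubring.unitGroup := by
    rw [Valuation.mem_unitGroup_iff]; exact hy'
  rw [← ha.image_inertia] at hmem
  obtain ⟨i, hi, rfl⟩ := Subgroup.mem_map.mp hmem
  rw [idelicCharacter_localUnits_canonicalArtin κ hΛ u i, inv_eq_one, ← mem_kerSubgroup]
  exact hI (Subgroup.mem_map.mpr ⟨WeilGroup.toAbsGalois _ i, WeilGroup.mem_inertia_iff.mp hi, rfl⟩)

/-- **Conversely: if `Λ` kills `𝒪_uˣ`, the line is unramified at `u` (`I_u ≤ ker κ`).** Every element of the chosen inertia group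
`GreenbergSelmer.inertia u` is `res_u w` for `w` in the Weil inertia (`WeilGroup.inertia_map_toAbsGalois`); `a_u(w)` is a local unit
(`IsLocalArtinMap.image_inertia`), so `κ(res_u w)⁻¹ = Λ(⟨a_u w⟩_u) = 1`. [cite: NeukirchANT1999, Ch. VI §5 Prop. (5.6)]
[cite: Washington1997, §13.1 (proof of Thm. 13.4)] -/
theorem inertia_le_kerSubgroup_of_idelicCharacter_localUnits_eq_one {u : HeightOneSpectrum (𝓞 K)}
    (h : ∀ y : (u.adicCompletion K)ˣ, Valued.v (y : u.adicCompletion K) = 1 → Λ (localUnits u y) = 1) :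
    GreenbergSelmer.inertia u ≤ κ.kerSubgroup := by
  intro σ hσ
  obtain ⟨σ₀, hσ₀, rfl⟩ := Subgroup.mem_map.mp hσ
  have hσ₀' : σ₀ ∈ (WeilGroup.inertia (u.adicCompletion K)).map (WeilGroup.toAbsGalois (u.adicCompletion K)) := by
    rw [WeilGroup.inertia_map_toAbsGalois]; exact hσ₀
  obtain ⟨w, hw, rfl⟩ := Subgroup.mem_map.mp hσ₀'
  have ha := isLocalArtinMap_canonicalArtin_holds (u.adicCompletion K)
  -- `a_u(w)` is a local unit
  have hmem : canonicalArtin (u.adicCompletion K) w ∈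
      (ValuativeRel.valuation (u.adicCompletion K)).valuationSubring.unitGroup := by
    rw [← ha.image_inertia]; exact Subgroup.mem_map.mpr ⟨w, hw, rfl⟩
  rw [Valuation.mem_unitGroup_iff] at hmem
  have hle : ∀ x z : u.adicCompletion K,
      ValuativeRel.valuation (u.adicCompletion K) x ≤ ValuativeRel.valuation (u.adicCompletion K) z ↔ Valued.v x ≤ Valued.v z :=
    fun x z ↦ (Valuation.vle_iff_le (ValuativeRel.valuation (u.adicCompletion K))).symm.trans (Valuation.vle_iff_le Valued.v)
  have hval : Valued.v ((canonicalArtin (u.adicCompletion K) w : (u.adicCompletion K)ˣ) : u.adicCompletion K) = 1 := by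
    have h1 : ValuativeRel.valuation (u.adicCompletion K)
        ((canonicalArtin (u.adicCompletion K) w : (u.adicCompletion K)ˣ) : u.adicCompletion K) ≤
        ValuativeRel.valuation (u.adicCompletion K) 1 := by rw [map_one, hmem]
    have h2 : ValuativeRel.valuation (u.adicCompletion K) 1 ≤ ValuativeRel.valuation (u.adicCompletion K)
        ((canonicalArtin (u.adicCompletion K) w : (u.adicCompletion K)ˣ) : u.adicCompletion K) := by rw [map_one, hmem]
    rw [hle, map_one] at h1 h2
    exact le_antisymm h1 h2
  have key := h _ hval
  rw [idelicCharacter_localUnits_canonicalArtin κ hΛ u w, inv_eq_one] at key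
  change κ.toContinuousMonoidHom _ = 1 at key
  rw [mem_kerSubgroup]
  exact key

/-- **`Λ(⟨𝒪_uˣ⟩) = 1` at every `u ≠ v`** for a line unramified outside `v` (away from `p`: Washington 13.2 via
`idelicCharacter_localUnits_integer`; above `p`: `idelicCharacter_localUnits_eq_one_of_inertia_le`), in `(𝒪_u)ˣ`-currency.
[cite: Washington1997, §13.1 Prop. 13.2] [cite: NeukirchANT1999, Ch. VI §5 Prop. (5.6)] -/
theorem idelicCharacter_unitsMap_eq_one_of_isUnramifiedOutside {v : HeightOneSpectrum (𝓞 K)} (hκ : κ.IsUnramifiedOutside v)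
    {u : HeightOneSpectrum (𝓞 K)} (hu : u ≠ v) (y : (u.adicCompletionIntegers K)ˣ) :
    Λ (localUnits u (Units.map ((u.adicCompletionIntegers K).subtype : _ →* _) y)) = 1 := by
  by_cases hpu : ((p : ℕ) : 𝓞 K) ∈ u.asIdeal
  · exact idelicCharacter_localUnits_eq_one_of_inertia_le κ hΛ (hκ u hu) _
      ((Valuation.Integers.isUnit_iff_valuation_eq_one (Valuation.valuationSubring.integers _)).1 (Units.isUnit y))
  · exact idelicCharacter_localUnits_integer κ hΛ hpu y

/-- **Unramified at `v̄` from the units of `𝒪_{v̄}`, in `(𝒪_{v̄})ˣ`-currency, ⟹ unramified outside `v`** (quadratic field, `v ≠ v̄ ∋ p`;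
at the places `u ∤ p` by Washington's Prop. 13.2, `inertia_le_kerSubgroup_holds`). [cite: Washington1997, §13.1 Prop. 13.2] -/
theorem isUnramifiedOutside_of_idelicCharacter_unitsMap_eq_one (hK2 : Module.finrank ℚ K = 2)
    {v vbar : HeightOneSpectrum (𝓞 K)} (hv : ((p : ℕ) : 𝓞 K) ∈ v.asIdeal) (hvbar : ((p : ℕ) : 𝓞 K) ∈ vbar.asIdeal) (hne : vbar ≠ v)
    (h : ∀ y : (vbar.adicCompletionIntegers K)ˣ, Λ (localUnits vbar (Units.map ((vbar.adicCompletionIntegers K).subtype : _ →* _) y)) = 1) :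
    κ.IsUnramifiedOutside v := by
  refine isUnramifiedOutside_of_forall_above (inertia_le_kerSubgroup_holds K p) κ v fun w hw hwv => ?_
  rcases eq_or_eq_of_natCast_mem_of_finrank_eq_two hK2 hv hvbar hne hw with rfl | rfl
  · exact absurd rfl hwv
  · refine inertia_le_kerSubgroup_of_idelicCharacter_localUnits_eq_one κ hΛ fun y hy => ?_
    obtain ⟨y', rfl⟩ := IdelicCharacter.exists_unitsMap_eq_of_valued_eq_one y hy
    exact h y'

end Idelic

/-! ### §3. Uniqueness -/

omit [NumberField K] [Fact p.Prime] in
/-- Cross-multiplication in a domain: `q a = c φ`, `q b = c' φ`, `q ≠ 0` give `c' a - c b = 0`. [folklore] -/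
private theorem sub_eq_zero_of_mul_eq_mul_of_mul_eq_mul {R : Type} [CommRing R] [NoZeroDivisors R] {q a b φ c c' : R} (hq : q ≠ 0)
    (h1 : q * a = c * φ) (h2 : q * b = c' * φ) : c' * a - c * b = 0 := by
  have h : q * (c' * a - c * b) = 0 := by
    calc q * (c' * a - c * b) = c' * (q * a) - c * (q * b) := by ring
      _ = 0 := by rw [h1, h2]; ring
  exact (mul_eq_zero.1 h).resolve_left hq

/-- **A `ℤ_p`-combination of two idelic characters is a continuous character** `a ↦ c₁ Λ₁(a) + c₂ Λ₂(a)` of the idele group. [folklore] -/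
private theorem exists_idelicCombination (Λ₁ Λ₂ : ideleGroup K →ₜ* Multiplicative ℤ_[p]) (c₁ c₂ : ℤ_[p]) :
    ∃ G : ideleGroup K →ₜ* Multiplicative ℤ_[p], ∀ x, (G x).toAdd = c₁ * (Λ₁ x).toAdd + c₂ * (Λ₂ x).toAdd := by
  refine ⟨{ toFun := fun x => Multiplicative.ofAdd (c₁ * (Λ₁ x).toAdd + c₂ * (Λ₂ x).toAdd)
            map_one' := by simp
            map_mul' := fun x y => by
              rw [← ofAdd_add]
              congr 1
              have h1 : (Λ₁ (x * y)).toAdd = (Λ₁ x).toAdd + (Λ₁ y).toAdd := by rw [map_mul, toAdd_mul]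
              have h2 : (Λ₂ (x * y)).toAdd = (Λ₂ x).toAdd + (Λ₂ y).toAdd := by rw [map_mul, toAdd_mul]
              rw [h1, h2]
              ring
            continuous_toFun := continuous_ofAdd.comp
              ((continuous_const.mul (continuous_toAdd.comp Λ₁.continuous)).add
                (continuous_const.mul (continuous_toAdd.comp Λ₂.continuous))) }, fun x => rfl⟩

/-- **The `v̄`-coordinate of the idelic character of a line unramified outside `v̄` is non-zero**: with `p^N Λ|_{𝒪_{v̄}ˣ} = c φ`, `c ≠ 0` —
else `Λ` kills every `𝒪_uˣ` above `p`, against `exists_idelicCharacter_localUnits_ne_one`. [cite: Lang1990, Ch. 5 §5, Thm. 5.1] -/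
theorem coeff_ne_zero_of_isUnramifiedOutside [IsTotallyComplex K] (κ : ZpExtension K p)
    {Λ : ideleGroup K →ₜ* Multiplicative ℤ_[p]}
    (hΛ : ∀ (a : ideleGroup K) (γ : absoluteGaloisGroup K),
      absGaloisAbProj K γ = ideleArtinMap K a → Λ a = κ.toContinuousMonoidHom γ)
    {vbar : HeightOneSpectrum (𝓞 K)} (hκ : κ.IsUnramifiedOutside vbar) {N : ℕ}
    {φ ψ : (vbar.adicCompletionIntegers K)ˣ →ₜ* Multiplicative ℤ_[p]}
    (hψ : ∀ y : (vbar.adicCompletionIntegers K)ˣ,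
      ψ y = Λ (localUnits vbar (Units.map ((vbar.adicCompletionIntegers K).subtype : _ →* _) y)))
    {c : ℤ_[p]} (hc : ∀ y : (vbar.adicCompletionIntegers K)ˣ, (p : ℤ_[p]) ^ N * (ψ y).toAdd = c * (φ y).toAdd) :
    c ≠ 0 := by
  intro hc0
  have hp : p.Prime := Fact.out
  obtain ⟨w, hw, y, hne⟩ := exists_idelicCharacter_localUnits_ne_one κ hΛ
  by_cases hwv : w = vbar
  · subst hwv
    apply hne
    have h := hc y
    rw [hc0, zero_mul, mul_eq_zero] at h
    have h' := h.resolve_left (pow_ne_zero _ (by exact_mod_cast hp.ne_zero))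
    rw [← hψ y]
    exact Multiplicative.toAdd.injective (h'.trans toAdd_one.symm)
  · exact hne (idelicCharacter_unitsMap_eq_one_of_isUnramifiedOutside κ hΛ hκ hwv y)

/-- **Two lines unramified outside `v̄` are proportional**: `K` imaginary quadratic, `v ≠ v̄` above `p`, `κ, κ'` unramified outside `v̄`;
then `c' · κ = c · κ'` for some NON-ZERO `c, c' ∈ ℤ_p` (idelic characters, rank one at `v̄`, a character of `C_K` killing
`∏_{u∣p} 𝒪_uˣ` is trivial, surjectivity of `[·, K]`). [cite: Washington1997, §13.1 (proof of Thm. 13.4)] [cite: Lang1990, Ch. 5 §5, Thm. 5.2] -/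
theorem exists_mul_eq_mul_of_isUnramifiedOutside (hK : IsImaginaryQuadratic K)
    {v vbar : HeightOneSpectrum (𝓞 K)} (hv : ((p : ℕ) : 𝓞 K) ∈ v.asIdeal) (hvbar : ((p : ℕ) : 𝓞 K) ∈ vbar.asIdeal)
    (hne : vbar ≠ v) (κ κ' : ZpExtension K p) (hκ : κ.IsUnramifiedOutside vbar) (hκ' : κ'.IsUnramifiedOutside vbar) :
    ∃ c c' : ℤ_[p], c ≠ 0 ∧ c' ≠ 0 ∧
      ∀ γ : absoluteGaloisGroup K, c' * (κ γ).toAdd = c * (κ' γ).toAdd := by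
  classical
  have hp : p.Prime := Fact.out
  haveI : IsTotallyComplex K := hK.2
  obtain ⟨Λ, hΛ⟩ := exists_idelicCharacter κ.toContinuousMonoidHom
  obtain ⟨Λ', hΛ'⟩ := exists_idelicCharacter κ'.toContinuousMonoidHom
  obtain ⟨N, φ, hφ⟩ := exists_localRank_one_of_split (p := p) hK.1 hv hvbar hne
  let res : (ideleGroup K →ₜ* Multiplicative ℤ_[p]) → ((vbar.adicCompletionIntegers K)ˣ →ₜ* Multiplicative ℤ_[p]) :=
    fun L => ⟨L.toMonoidHom.comp ((localUnits vbar).comp (Units.map ((vbar.adicCompletionIntegers K).subtype :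
        vbar.adicCompletionIntegers K →* vbar.adicCompletion K))),
      L.continuous.comp (IdelicCharacter.continuous_localUnits_unitsMap vbar)⟩
  have hres : ∀ L (y : (vbar.adicCompletionIntegers K)ˣ), res L y =
      L (localUnits vbar (Units.map ((vbar.adicCompletionIntegers K).subtype : _ →* _) y)) := fun L y => rfl
  obtain ⟨c, hc⟩ := hφ (res Λ)
  obtain ⟨c', hc'⟩ := hφ (res Λ')
  have hc0 : c ≠ 0 := coeff_ne_zero_of_isUnramifiedOutside κ hΛ hκ (hres Λ) hc
  have hc'0 : c' ≠ 0 := coeff_ne_zero_of_isUnramifiedOutside κ' hΛ' hκ' (hres Λ') hc'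
  -- `G = c' Λ - c Λ'`
  obtain ⟨G, hG⟩ := exists_idelicCombination Λ Λ' c' (-c)
  have hGprinc : ∀ x ∈ principalIdeles K, G x = 1 := fun x hx => by
    apply Multiplicative.toAdd.injective
    rw [hG, toAdd_one, idelicCharacter_eq_one_of_mem_principalIdeles hΛ hx,
      idelicCharacter_eq_one_of_mem_principalIdeles hΛ' hx, toAdd_one, mul_zero, mul_zero, add_zero]
  have hGloc : ∀ w : HeightOneSpectrum (𝓞 K), (p : 𝓞 K) ∈ w.asIdeal →
      ∀ y : (w.adicCompletionIntegers K)ˣ,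
        G (localUnits w (Units.map ((w.adicCompletionIntegers K).subtype : _ →* _) y)) = 1 := by
    intro w hw y
    apply Multiplicative.toAdd.injective
    rw [hG, toAdd_one]
    by_cases hwv : w = vbar
    · subst hwv
      have hpN : (p : ℤ_[p]) ^ N ≠ 0 := pow_ne_zero _ (by exact_mod_cast hp.ne_zero)
      rw [← hres Λ, ← hres Λ', neg_mul, ← sub_eq_add_neg]
      exact sub_eq_zero_of_mul_eq_mul_of_mul_eq_mul hpN (hc y) (hc' y)
    · rw [idelicCharacter_unitsMap_eq_one_of_isUnramifiedOutside κ hΛ hκ hwv y,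
        idelicCharacter_unitsMap_eq_one_of_isUnramifiedOutside κ' hΛ' hκ' hwv y, toAdd_one, mul_zero, mul_zero, add_zero]
  have hG1 : G = 1 := IdelicCharacter.eq_one_of_forall_localUnits (p := p) G hGprinc hGloc
  refine ⟨c, c', hc0, hc'0, fun γ => ?_⟩
  obtain ⟨a, ha⟩ := exists_ideleArtinMap_eq (K := K) γ
  have h := congrArg Multiplicative.toAdd (DFunLike.congr_fun hG1 a)
  rw [hG, hΛ a γ ha.symm, hΛ' a γ ha.symm] at h
  change c' * (κ γ).toAdd + (-c) * (κ' γ).toAdd = (1 : Multiplicative ℤ_[p]).toAdd at h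
  rw [toAdd_one, neg_mul, ← sub_eq_add_neg, sub_eq_zero] at h
  exact h

/-- **UNIQUENESS: two `ℤ_p`-extensions of an imaginary quadratic field unramified outside a split prime `v̄` have the same kernel.**
[cite: Agboola2007, §1 p. 1 (arXiv p0003:L3–11)] [cite: deShalit1987, II §4.17] [cite: Washington1997, §13.1 Thm. 13.4] -/
theorem kerSubgroup_eq_of_isUnramifiedOutside (hK : IsImaginaryQuadratic K)
    {v vbar : HeightOneSpectrum (𝓞 K)} (hv : ((p : ℕ) : 𝓞 K) ∈ v.asIdeal) (hvbar : ((p : ℕ) : 𝓞 K) ∈ vbar.asIdeal)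
    (hne : vbar ≠ v) (κ κ' : ZpExtension K p) (hκ : κ.IsUnramifiedOutside vbar) (hκ' : κ'.IsUnramifiedOutside vbar) :
    κ'.kerSubgroup = κ.kerSubgroup := by
  obtain ⟨c, c', hc0, hc'0, hrel⟩ := exists_mul_eq_mul_of_isUnramifiedOutside hK hv hvbar hne κ κ' hκ hκ'
  ext γ
  rw [mem_kerSubgroup, mem_kerSubgroup]
  have h := hrel γ
  constructor
  · intro h1
    rw [h1, toAdd_one, mul_zero, mul_eq_zero] at h
    exact Multiplicative.toAdd.injective ((h.resolve_left hc'0).trans toAdd_one.symm)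
  · intro h1
    rw [h1, toAdd_one, mul_zero] at h
    exact Multiplicative.toAdd.injective (((mul_eq_zero.1 h.symm).resolve_left hc0).trans toAdd_one.symm)

/-! ### §4. Existence -/

/-- **EXISTENCE: an imaginary quadratic field has a `ℤ_p`-extension unramified outside any given one of two split places above `p`.**
`v ≠ v̄` above `p`; two jointly surjective characters `κ₁, κ₂ : Γ_K → ℤ_p` (`exists_pair_of_globalReciprocity`, global reciprocity law
`exists_isGlobalReciprocityMap_holds`); rank one of `Hom_cont(𝒪_{v̄}ˣ, ℤ_p)` gives a non-trivial combination `χ = c₂κ₁ − c₁κ₂` whose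
idelic character kills `𝒪_{v̄}ˣ` (or `κ₁` already does); its saturation is a line unramified at `v̄`, hence outside `v`.
[cite: Agboola2007, §1 p. 1 (arXiv p0003:L9–11)] [cite: Washington1997, §13.1 Thm. 13.4] [cite: Coates1983InfiniteDescent, §2] -/
theorem exists_isUnramifiedOutside_of_split (hK : IsImaginaryQuadratic K)
    {v vbar : HeightOneSpectrum (𝓞 K)} (hv : ((p : ℕ) : 𝓞 K) ∈ v.asIdeal) (hvbar : ((p : ℕ) : 𝓞 K) ∈ vbar.asIdeal)
    (hne : vbar ≠ v) : ∃ κ : ZpExtension K p, κ.IsUnramifiedOutside v := by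
  classical
  have hp : p.Prime := Fact.out
  haveI : IsTotallyComplex K := hK.2
  haveI : CompactSpace (absoluteGaloisGroup K) := absoluteGaloisGroup_compactSpace K
  have h0 : NumberField.Units.rank K = 0 :=
    units_rank_eq_zero_of_finrank_eq_two hK.1 fun w => IsTotallyComplex.isComplex w
  obtain ⟨κ₁, κ₂, hsurj⟩ := exists_pair_of_globalReciprocity (p := p) hK.1 h0 (exists_isGlobalReciprocityMap_holds K)
  have hsurj₁ : Function.Surjective κ₁ := fun y => by
    obtain ⟨σ, hσ⟩ := hsurj (y.toAdd, 0)
    exact ⟨σ, Multiplicative.toAdd.injective (congrArg Prod.fst hσ)⟩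
  have hsurj₂ : Function.Surjective κ₂ := fun y => by
    obtain ⟨σ, hσ⟩ := hsurj (0, y.toAdd)
    exact ⟨σ, Multiplicative.toAdd.injective (congrArg Prod.snd hσ)⟩
  let K₁ : ZpExtension K p := ⟨κ₁, hsurj₁⟩
  let K₂ : ZpExtension K p := ⟨κ₂, hsurj₂⟩
  obtain ⟨Λ₁, hΛ₁⟩ := exists_idelicCharacter K₁.toContinuousMonoidHom
  obtain ⟨Λ₂, hΛ₂⟩ := exists_idelicCharacter K₂.toContinuousMonoidHom
  obtain ⟨N, φ, hφ⟩ := exists_localRank_one_of_split (p := p) hK.1 hv hvbar hne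
  let res : (ideleGroup K →ₜ* Multiplicative ℤ_[p]) → ((vbar.adicCompletionIntegers K)ˣ →ₜ* Multiplicative ℤ_[p]) :=
    fun L => ⟨L.toMonoidHom.comp ((localUnits vbar).comp (Units.map ((vbar.adicCompletionIntegers K).subtype :
        vbar.adicCompletionIntegers K →* vbar.adicCompletion K))),
      L.continuous.comp (IdelicCharacter.continuous_localUnits_unitsMap vbar)⟩
  have hres : ∀ L (y : (vbar.adicCompletionIntegers K)ˣ), res L y =
      L (localUnits vbar (Units.map ((vbar.adicCompletionIntegers K).subtype : _ →* _) y)) := fun L y => rfl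
  obtain ⟨c₁, hc₁⟩ := hφ (res Λ₁)
  obtain ⟨c₂, hc₂⟩ := hφ (res Λ₂)
  have hpN : (p : ℤ_[p]) ^ N ≠ 0 := pow_ne_zero _ (by exact_mod_cast hp.ne_zero)
  by_cases hc : c₁ = 0 ∧ c₂ = 0
  · -- `Λ₁` kills `𝒪_{v̄}ˣ`: `κ₁` itself is unramified at `v̄`
    refine ⟨K₁, isUnramifiedOutside_of_idelicCharacter_unitsMap_eq_one K₁ hΛ₁ hK.1 hv hvbar hne fun y => ?_⟩
    have h := hc₁ y
    rw [hc.1, zero_mul, mul_eq_zero] at h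
    rw [← hres Λ₁]
    exact Multiplicative.toAdd.injective ((h.resolve_left hpN).trans toAdd_one.symm)
  · -- `χ = c₂ κ₁ - c₁ κ₂ ≠ 0`, saturated to a line `K₃` whose idelic character kills `𝒪_{v̄}ˣ`
    let χ : absoluteGaloisGroup K →ₜ* Multiplicative ℤ_[p] :=
      { toFun := fun σ => Multiplicative.ofAdd (c₂ * (κ₁ σ).toAdd + (-c₁) * (κ₂ σ).toAdd)
        map_one' := by simp
        map_mul' := fun x y => by
          rw [← ofAdd_add]
          congr 1
          have h1 : (κ₁ (x * y)).toAdd = (κ₁ x).toAdd + (κ₁ y).toAdd := by rw [map_mul, toAdd_mul]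
          have h2 : (κ₂ (x * y)).toAdd = (κ₂ x).toAdd + (κ₂ y).toAdd := by rw [map_mul, toAdd_mul]
          rw [h1, h2]
          ring
        continuous_toFun := continuous_ofAdd.comp
          ((continuous_const.mul (continuous_toAdd.comp κ₁.continuous)).add
            (continuous_const.mul (continuous_toAdd.comp κ₂.continuous))) }
    have hχ : ∀ σ, (χ σ).toAdd = c₂ * (κ₁ σ).toAdd + (-c₁) * (κ₂ σ).toAdd := fun σ => rfl
    have hχ1 : χ ≠ 1 := by
      intro h1
      obtain ⟨σ, hσ⟩ := hsurj (1, 0)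
      obtain ⟨τ, hτ⟩ := hsurj (0, 1)
      simp only [Prod.mk.injEq] at hσ hτ
      have e1 := hχ σ
      have e2 := hχ τ
      rw [h1, hσ.1, hσ.2] at e1
      rw [h1, hτ.1, hτ.2] at e2
      change (1 : Multiplicative ℤ_[p]).toAdd = _ at e1 e2
      rw [toAdd_one, mul_one, mul_zero, add_zero] at e1
      rw [toAdd_one, mul_zero, mul_one, zero_add] at e2
      exact hc ⟨neg_eq_zero.mp e2.symm, e1.symm⟩
    obtain ⟨g, k, hg, hgχ⟩ := exists_surjective_of_ne_one χ hχ1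
    let K₃ : ZpExtension K p := ⟨g, hg⟩
    obtain ⟨Λ₃, hΛ₃⟩ := exists_idelicCharacter K₃.toContinuousMonoidHom
    refine ⟨K₃, isUnramifiedOutside_of_idelicCharacter_unitsMap_eq_one K₃ hΛ₃ hK.1 hv hvbar hne fun y => ?_⟩
    -- `p^k Λ₃ = c₂ Λ₁ - c₁ Λ₂` (all three read at one `γ` over the idele), so `p^N p^k Λ₃ = 0` on `𝒪_{v̄}ˣ`
    set a := localUnits vbar (Units.map ((vbar.adicCompletionIntegers K).subtype : _ →* _) y) with ha_def
    obtain ⟨γ, hγ⟩ := QuotientGroup.mk_surjective (ideleArtinMap K a)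
    have e₁ : Λ₁ a = κ₁ γ := hΛ₁ a γ hγ
    have e₂ : Λ₂ a = κ₂ γ := hΛ₂ a γ hγ
    have e₃ : Λ₃ a = g γ := hΛ₃ a γ hγ
    have hrel : (p : ℤ_[p]) ^ k * (Λ₃ a).toAdd = c₂ * (Λ₁ a).toAdd + (-c₁) * (Λ₂ a).toAdd := by
      rw [e₁, e₂, e₃, ← hgχ γ, hχ]
    have hpk : (p : ℤ_[p]) ^ k ≠ 0 := pow_ne_zero _ (by exact_mod_cast hp.ne_zero)
    have hzero : (p : ℤ_[p]) ^ N * ((p : ℤ_[p]) ^ k * (Λ₃ a).toAdd) = 0 := by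
      rw [hrel, mul_add, ← mul_assoc, ← mul_assoc, mul_comm ((p : ℤ_[p]) ^ N) c₂, mul_comm ((p : ℤ_[p]) ^ N) (-c₁),
        mul_assoc, mul_assoc, ha_def, ← hres Λ₁, ← hres Λ₂, hc₁ y, hc₂ y]
      ring
    have h3 : (Λ₃ a).toAdd = 0 :=
      ((mul_eq_zero.1 ((mul_eq_zero.1 hzero).resolve_left hpN)).resolve_left hpk)
    exact Multiplicative.toAdd.injective (h3.trans toAdd_one.symm)

/-! ### §5. The named fact -/

/-- **Discharge of `Literature.NumberTheory.EllipticCurves.ZpExtension.existsUnique_isUnramifiedOutside_of_split`** (class field theory: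
existence and uniqueness of the `ℤ_p`-extension of an imaginary quadratic field unramified outside ONE of the two primes above a split
`p` — «the unique `ℤ_p` extension of `K` unramified outside `𝔭`»), for every prime `p`, proved exactly as vendored.
[cite: Agboola2007, §1 p. 1 (arXiv p0003:L3–11)] [cite: deShalit1987, II §4.17] [cite: Coates1983InfiniteDescent, §2]
[cite: Washington1997, §13.1 Thm. 13.4] -/
theorem existsUnique_isUnramifiedOutside_of_split_holds : existsUnique_isUnramifiedOutside_of_split := by
  intro p _ K _ _ hK v vbar hv hvbar hne
  exact ⟨exists_isUnramifiedOutside_of_split hK hv hvbar hne,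
    fun κ κ' hκ hκ' => kerSubgroup_eq_of_isUnramifiedOutside hK hvbar hv hne.symm κ κ' hκ hκ'⟩

end Literature.NumberTheory.EllipticCurves.ZpExtension

end
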